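import Summits.NavierStokesRegularity.NavierStokesRegularity.Theorems.SoloSalvageWu2026CutoffRadial
import Summits.NavierStokesRegularity.NavierStokesRegularity.Theorems.SoloSalvageWu2026Tails
import Summits.NavierStokesRegularity.NavierStokesRegularity.Theorems.SoloSalvageWu2026Flux
import Literature.Analysis.FluidPDE.TsaiGradientEstimate
import Literature.Analysis.FluidPDE.SteadyNSCaccioppoliTools
import Literature.Analysis.FluidPDE.HessianLaplacian
import HarnessLib

/-!
# C177 `Wu2026` — SALVAGE (TRUE column): the harmonic cut-off inequality (3.82) in its consumed form,
# `∫ Φ_R ν|∇v|² ≤ −R ∫_{|x|>R} 𝒬 v·x |x|^{−3}` — second conjunct of `Step_382`; `step_382 : Step_382`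

Cell `ns-claims` (D-0090), lane ns-claims-salvage-p6 g5 (handover of salvage-p3 g6's CLOSING §); records-
grade for the row (#164 «discharges», KIT NONE). Text of record arXiv:2608.22471v1, (3.72)–(3.82)
p.23 l.53 – p.25 l.126; Remark 3.5 p.26 («the sphere term is used only through its nonnegativity»).

## Proof (one dominated-convergence limit; no surface measure)

For `n ∈ ℕ` put `ε_n = (n+1)⁻¹`, `L_n = 2R + 2 + n`, `h_n = radialProfile R ε_n` (smooth, superharmonic,
`0 ≤ h_n ≤ min{1, R/|x|}`, `∇h_n(x) = −R·rampDens(|x|²) x`, file `…CutoffRadial`), `χ_n` = the energy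
cut-off of `SteadyNSCaccioppoliTools.exists_energyCutoff` at scale `L_n` (`= 1` on `B_{3L_n/4}`,
`‖Dχ_n‖ ≤ C₁/|x|`, `|Δχ_n| ≤ C₂/|x|²` on its shell), `φ_n = h_n χ_n ∈ C²_c`. The steady energy identity
tested with `φ_n v` (tree `IsLerayProfile.integral_mul_frobeniusNormSq_fderiv_eq`, rate `a = 0`, constant `c`):
`ν∫φ_n|∇v|² = (ν/2)∫Δφ_n|v|² + ∫𝒬 Dφ_n(v)`, `𝒬 = (p − c) + |v|²/2`; Leibniz `Δφ_n = χ_nΔh_n + h_nΔχ_n +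
2Σ∂ᵢh_n∂ᵢχ_n` (`laplacian_mul_eq`) and `χ_nΔh_n|v|² ≤ 0` give `ν∫φ_n|∇v|² ≤ ∫F_n` with
`F_n = (ν/2)(h_nΔχ_n + 2Σ∂ᵢh_n∂ᵢχ_n)|v|² + 𝒬 Dφ_n(v)`. Pointwise `F_n(x)` is EVENTUALLY EQUAL to
`−R 𝟙_{|x|>R} 𝒬 ⟪x,v⟫|x|^{−3}` (the cut-off stabilises at `1`, the ramp at `1`), and uniformly
`|F_n| ≤ 𝟙_{|x|>R}[(ν/2)R(C₂+6C₁)|v|²|x|^{−3} + (1+C₁)R|𝒬||v||x|^{−2}] ∈ L¹` by the tails of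
`SoloSalvageWu2026Tails` (`v ∈ L⁶` from `D < ∞`, `p − c ∈ L^{9/4,∞}`); on the left `φ_n → Φ_R` pointwise
with `0 ≤ φ_n ≤ 1`, `|∇v|² ∈ L¹`. Dominated convergence on both sides and `le_of_tendsto_of_tendsto'`
give `cutoffEnergy ν R v ≤ current382 R v (p − c)`; with `integrableOn_current` (salvage-p3 g6) this is
`Step_382`. [cite: Wu2026, (3.72)–(3.82) p.23–25; Remark 3.5 p.26]

WHAT THIS IS NOT: not a claim about NS regularity or blow-up; not a claim about any author beyond the
typed locator.
-/

set_option linter.dupNamespace false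

noncomputable section

open MeasureTheory Set Filter Topology InnerProductSpace Metric
open scoped RealInnerProductSpace Laplacian Topology ENNReal

namespace Summit.NavierStokesRegularity.NavierStokesRegularity.Theorems.Wu2026Salvage

open Literature.Analysis.FluidPDE Literature.Analysis.FunctionSpaces Literature.Claims.NS.Wu2026

/-! ### §1 The tested energy identity with the Bernoulli function -/

/-- `⟪w, ∇φ(x)⟫ = Dφ(x) w`. [cite: Wu2026, (3.72) p.23 (div(𝒬v) tested)] -/
theorem inner_gradient_right_eq (φ : E3 → ℝ) (x w : E3) : ⟪w, gradient φ x⟫ = fderiv ℝ φ x w := by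
  rw [real_inner_comm, gradient, InnerProductSpace.toDual_symm_apply]

/-- **The steady energy identity tested against `φ v`, Bernoulli form** (the integrated (3.72)):
for an `IsWuFlow`, `φ ∈ C²_c` and any constant `c`,
`ν ∫ φ|∇v|² = (ν/2)∫ Δφ |v|² + ∫ 𝒬 · Dφ(v)` with `𝒬 = (p − c) + |v|²/2`.
[cite: Wu2026, (3.72) p.23 l.53–60; (3.81) p.25] -/
theorem energy_identity_bern {ν : ℝ} {v : E3 → E3} {p : E3 → ℝ} (hflow : IsWuFlow ν v p)
    {φ : E3 → ℝ} (hφ : ContDiff ℝ 2 φ) (hφc : HasCompactSupport φ) (c : ℝ) :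
    ν * ∫ x, φ x * frobeniusNormSq (fderiv ℝ v x) =
      (ν / 2) * (∫ x, (Δ φ) x * ‖v x‖ ^ 2) +
        ∫ x, bern v (fun y => p y - c) x * fderiv ℝ φ x (v x) := by
  have h := hflow.profile.integral_mul_frobeniusNormSq_fderiv_eq hflow.smooth_v hφ hφc c
  simp only [zero_div, zero_mul, add_zero] at h
  rw [h, add_assoc]
  congr 1
  -- `(1/2)∫ Dφ(v)|v|² + ∫ (p − c)⟪v, ∇φ⟫ = ∫ 𝒬 Dφ(v)`
  have hvc : Continuous v := hflow.smooth_v.continuous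
  have hpc : Continuous p := hflow.smooth_p.continuous
  have hφ1 : ContDiff ℝ 1 φ := hφ.of_le one_le_two
  have hDφc : Continuous fun x => fderiv ℝ φ x (v x) :=
    (hφ1.continuous_fderiv one_ne_zero).clm_apply hvc
  have hDφcs : HasCompactSupport fun x => fderiv ℝ φ x (v x) :=
    (hφc.fderiv (𝕜 := ℝ)).mono fun x hx h => hx (show fderiv ℝ φ x (v x) = 0 by rw [h]; rfl)
  have i1 : Integrable fun x => fderiv ℝ φ x (v x) * ‖v x‖ ^ 2 :=
    (hDφc.mul (hvc.norm.pow 2)).integrable_of_hasCompactSupport hDφcs.mul_right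
  have i2 : Integrable fun x => (p x - c) * fderiv ℝ φ x (v x) :=
    ((hpc.sub continuous_const).mul hDφc).integrable_of_hasCompactSupport hDφcs.mul_left
  have e2 : ∫ x, (p x - c) * ⟪v x, gradient φ x⟫ = ∫ x, (p x - c) * fderiv ℝ φ x (v x) :=
    integral_congr_ae (Eventually.of_forall fun x => by simp only [inner_gradient_right_eq])
  rw [e2, ← integral_const_mul, ← integral_add (i1.const_mul _) i2]
  refine integral_congr_ae (Eventually.of_forall fun x => ?_)
  simp only [bern]
  ring

/-! ### §2 Tails: the dominating function is integrable -/

/-- Integrability on `{|x| > R}` of `A|v|²|x|^{−3} + B(|q||v| + |v|³)|x|^{−2}` for an `IsWuFlow` with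
`D < ∞` and `q = p − c ∈ L^{9/4,∞}` — the three tails of `SoloSalvageWu2026Tails`.
[cite: Wu2026, (3.73)–(3.74) p.24; p.25 l.21–30] -/
theorem integrable_dominator {ν : ℝ} {v : E3 → E3} {p : E3 → ℝ} (hflow : IsWuFlow ν v p)
    (hD : dirichlet v < ∞) {q : E3 → ℝ} (hqc : Continuous q) (hq : MemWeakLp q ((9 : ℝ≥0∞) / 4) volume)
    {R : ℝ} (hR : 0 < R) (A B : ℝ) (hA : 0 ≤ A) (hB : 0 ≤ B) :
    Integrable fun x => ({x : E3 | R < ‖x‖}).indicator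
      (fun x => A * ‖v x‖ ^ 2 * (‖x‖ ^ 3)⁻¹ + B * ((|q x| * ‖v x‖ + ‖v x‖ ^ 3) * (‖x‖ ^ 2)⁻¹)) x := by
  have hv1 : ContDiff ℝ 1 v := hflow.smooth_v.of_le (by exact_mod_cast le_top)
  have hvc : Continuous v := hv1.continuous
  have hvm : AEStronglyMeasurable v volume := hvc.aestronglyMeasurable
  have h6 : eLpNorm v 6 volume < ∞ := (memLp_six_of_dirichlet_lt_top hv1 hflow.decay hD).2
  set S : Set E3 := {x : E3 | R < ‖x‖} with hS
  have hSm : MeasurableSet S := measurableSet_lt measurable_const measurable_norm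
  rw [integrable_indicator_iff hSm]
  have hT1 := lintegral_exterior_cube_lt_top hvm h6 hR
  have hT2 := lintegral_exterior_pressure_lt_top hvm h6 hq hR
  have hT3 := lintegral_exterior_sq_lt_top hvm h6 hR
  set g : E3 → ℝ := fun x => A * ‖v x‖ ^ 2 * (‖x‖ ^ 3)⁻¹ +
    B * ((|q x| * ‖v x‖ + ‖v x‖ ^ 3) * (‖x‖ ^ 2)⁻¹) with hg
  have hgm : AEStronglyMeasurable g (volume.restrict S) := by
    refine Measurable.aestronglyMeasurable ?_
    have hn : Measurable fun x : E3 => ‖x‖ := measurable_norm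
    have hv' : Measurable fun x => ‖v x‖ := hvc.norm.measurable
    have hq' : Measurable fun x => |q x| := (hqc.abs).measurable
    exact ((measurable_const.mul (hv'.pow_const 2)).mul (hn.pow_const 3).inv).add
      (measurable_const.mul (((hq'.mul hv').add (hv'.pow_const 3)).mul (hn.pow_const 2).inv))
  refine ⟨hgm, ?_⟩
  -- the three tail densities in `ℝ≥0∞`
  set Fp : E3 → ℝ≥0∞ := fun x => ‖q x‖ₑ * ‖v x‖ₑ * ENNReal.ofReal (‖x‖ ^ (-(2 : ℝ))) with hFp
  set Fc : E3 → ℝ≥0∞ := fun x => ‖v x‖ₑ ^ (3 : ℝ) * ENNReal.ofReal (‖x‖ ^ (-(2 : ℝ))) with hFc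
  set Fa : E3 → ℝ≥0∞ := fun x => ‖v x‖ₑ ^ (2 : ℝ) * ENNReal.ofReal (‖x‖ ^ (-(3 : ℝ))) with hFa
  have hpow : ∀ (w : E3) (n : ℕ), ENNReal.ofReal (‖w‖ ^ n) = ‖w‖ₑ ^ (n : ℝ) := fun w n => by
    rw [ENNReal.rpow_natCast, ← ofReal_norm, ENNReal.ofReal_pow (norm_nonneg _)]
  -- pointwise: `‖g x‖ₑ ≤ A·Fa + B·(Fp + Fc)` on `S`
  have hmono : ∀ x ∈ S, ‖g x‖ₑ ≤ ENNReal.ofReal A * Fa x + ENNReal.ofReal B * (Fp x + Fc x) := by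
    intro x hx
    have hx0 : 0 < ‖x‖ := hR.trans hx
    have hgx : 0 ≤ g x := by rw [hg]; positivity
    have e3 : (‖x‖ ^ 3)⁻¹ = ‖x‖ ^ (-(3 : ℝ)) := by
      rw [Real.rpow_neg hx0.le, show (‖x‖ ^ (3 : ℝ)) = ‖x‖ ^ (3 : ℕ) by norm_cast]
    have e2 : (‖x‖ ^ 2)⁻¹ = ‖x‖ ^ (-(2 : ℝ)) := by
      rw [Real.rpow_neg hx0.le, show (‖x‖ ^ (2 : ℝ)) = ‖x‖ ^ (2 : ℕ) by norm_cast]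
    have hgeq : g x = A * (‖v x‖ ^ 2 * ‖x‖ ^ (-(3 : ℝ))) +
        B * (|q x| * ‖v x‖ * ‖x‖ ^ (-(2 : ℝ)) + ‖v x‖ ^ 3 * ‖x‖ ^ (-(2 : ℝ))) := by
      simp only [hg]; rw [e3, e2]; ring
    have ha : ENNReal.ofReal (‖v x‖ ^ 2 * ‖x‖ ^ (-(3 : ℝ))) = Fa x := by
      rw [hFa, ENNReal.ofReal_mul (by positivity), hpow]; norm_num
    have hp' : ENNReal.ofReal (|q x| * ‖v x‖ * ‖x‖ ^ (-(2 : ℝ))) = Fp x := by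
      rw [hFp, ENNReal.ofReal_mul (by positivity), ENNReal.ofReal_mul (abs_nonneg _),
        ← Real.enorm_eq_ofReal_abs, ofReal_norm]
    have hc' : ENNReal.ofReal (‖v x‖ ^ 3 * ‖x‖ ^ (-(2 : ℝ))) = Fc x := by
      rw [hFc, ENNReal.ofReal_mul (by positivity), hpow]; norm_num
    rw [Real.enorm_eq_ofReal hgx, hgeq, ENNReal.ofReal_add (by positivity) (by positivity),
      ENNReal.ofReal_mul hA, ENNReal.ofReal_mul hB, ENNReal.ofReal_add (by positivity) (by positivity),
      ha, hp', hc']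
  unfold HasFiniteIntegral
  have hmeasF : AEMeasurable Fp (volume.restrict S) :=
    ((hqc.measurable.enorm.mul hvc.measurable.enorm).mul
      ((continuous_norm.measurable.pow_const _).ennreal_ofReal)).aemeasurable
  have hmeasC : AEMeasurable Fc (volume.restrict S) :=
    ((hvc.measurable.enorm.pow_const _).mul
      ((continuous_norm.measurable.pow_const _).ennreal_ofReal)).aemeasurable
  have hmeasA : AEMeasurable Fa (volume.restrict S) :=
    ((hvc.measurable.enorm.pow_const _).mul
      ((continuous_norm.measurable.pow_const _).ennreal_ofReal)).aemeasurable
  have hmeasFC : AEMeasurable (fun x => Fp x + Fc x) (volume.restrict S) := hmeasF.add hmeasC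
  have hsplit : ∫⁻ x in S, (ENNReal.ofReal A * Fa x + ENNReal.ofReal B * (Fp x + Fc x)) =
      ENNReal.ofReal A * (∫⁻ x in S, Fa x) + ENNReal.ofReal B * ((∫⁻ x in S, Fp x) + ∫⁻ x in S, Fc x) := by
    rw [lintegral_add_left' (hmeasA.const_mul _), lintegral_const_mul'' _ hmeasA,
      lintegral_const_mul'' _ hmeasFC, lintegral_add_left' hmeasF]
  calc ∫⁻ x in S, ‖g x‖ₑ
      ≤ ∫⁻ x in S, (ENNReal.ofReal A * Fa x + ENNReal.ofReal B * (Fp x + Fc x)) :=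
        setLIntegral_mono' hSm hmono
    _ = ENNReal.ofReal A * (∫⁻ x in S, Fa x) + ENNReal.ofReal B * ((∫⁻ x in S, Fp x) + ∫⁻ x in S, Fc x) :=
        hsplit
    _ < ∞ := by
        refine ENNReal.add_lt_top.2 ⟨ENNReal.mul_lt_top ENNReal.ofReal_lt_top hT3,
          ENNReal.mul_lt_top ENNReal.ofReal_lt_top (ENNReal.add_lt_top.2 ⟨hT2, hT1⟩)⟩


/-! ### §3 One tested inequality: `ν∫ h χ |∇v|² ≤ ∫ F` for the superharmonic profile `h` and a cut-off `χ` -/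

/-- The integrand `F` of the right-hand side after dropping the signed term `χΔh|v|² ≤ 0`:
`F = (ν/2)(hΔχ + 2Σᵢ∂ᵢh∂ᵢχ)|v|² + 𝒬·(h Dχ(v) + χ Dh(v))` (the right-hand side of (3.81) plus the
current term). [cite: Wu2026, (3.81) p.25 l.1–10] -/
def testedRHS (ν : ℝ) (v : E3 → E3) (q : E3 → ℝ) (h χ : E3 → ℝ) (x : E3) : ℝ :=
  ν / 2 * ((h x * (Δ χ) x +
      2 * ∑ i, fderiv ℝ h x (stdOrthonormalBasis ℝ E3 i) * fderiv ℝ χ x (stdOrthonormalBasis ℝ E3 i)) *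
        ‖v x‖ ^ 2) +
    bern v q x * (h x * fderiv ℝ χ x (v x) + χ x * fderiv ℝ h x (v x))

/-- The Laplacian of a compactly supported `C²` function has compact support. [folklore] -/
private theorem hasCompactSupport_laplacian {χ : E3 → ℝ} (hχc : HasCompactSupport χ) :
    HasCompactSupport (Δ χ) :=
  hχc.mono' fun y hy => by
    contrapose! hy
    simp [Literature.Analysis.FluidPDE.laplacian_eq_zero_of_notMem_tsupport hy]

/-- Directional derivatives of a compactly supported function have compact support. [folklore] -/
private theorem hasCompactSupport_fderiv_apply' {χ : E3 → ℝ} (hχc : HasCompactSupport χ) (w : E3) :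
    HasCompactSupport fun x => fderiv ℝ χ x w :=
  (hχc.fderiv (𝕜 := ℝ)).mono fun x hx h => hx (show fderiv ℝ χ x w = 0 by rw [h]; rfl)

/-- **The tested inequality (3.81) without the sphere term.** For an `IsWuFlow` (`ν > 0`), the
superharmonic profile `h = radialProfile R ε` and any cut-off `χ ∈ C_c^∞`, `0 ≤ χ ≤ 1`:
`ν ∫ hχ |∇v|² ≤ ∫ F` with `F = testedRHS` — the energy identity for `φ = hχ`, Leibniz
`Δ(hχ) = hΔχ + χΔh + 2Σ∂ᵢh∂ᵢχ`, and `χΔh|v|² ≤ 0` dropped (this is where the print's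
«favorable sign of the sphere term», (3.80)/(3.82), is used). [cite: Wu2026, (3.81)–(3.82) p.25; Remark 3.5 p.26] -/
theorem tested_le {ν : ℝ} (hν : 0 < ν) {v : E3 → E3} {p : E3 → ℝ} (hflow : IsWuFlow ν v p)
    {R ε : ℝ} (hR : 0 < R) (hε : 0 < ε) {χ : E3 → ℝ} (hχ : ContDiff ℝ 2 χ) (hχc : HasCompactSupport χ)
    (hχ0 : ∀ x, 0 ≤ χ x) (c : ℝ) :
    ν * ∫ x, (radialProfile R ε x * χ x) * frobeniusNormSq (fderiv ℝ v x) ≤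
      ∫ x, testedRHS ν v (fun y => p y - c) (radialProfile R ε) χ x := by
  set h : E3 → ℝ := radialProfile R ε with hh
  set b := stdOrthonormalBasis ℝ E3 with hb
  set q : E3 → ℝ := fun y => p y - c with hq
  have hh2 : ContDiff ℝ 2 h := contDiff_radialProfile hR hε
  have hh1 : ContDiff ℝ 1 h := hh2.of_le one_le_two
  have hχ1 : ContDiff ℝ 1 χ := hχ.of_le one_le_two
  have hφ2 : ContDiff ℝ 2 (fun x => h x * χ x) := hh2.mul hχ
  have hφc : HasCompactSupport (fun x => h x * χ x) := hχc.mul_left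
  -- continuity of the players
  have hvc : Continuous v := hflow.smooth_v.continuous
  have hpc : Continuous p := hflow.smooth_p.continuous
  have hbc : Continuous (bern v q) := by
    unfold bern; exact (hpc.sub continuous_const).add ((hvc.norm.pow 2).div_const 2)
  have hhc : Continuous h := hh2.continuous
  have hχcn : Continuous χ := hχ.continuous
  have hΔhc : Continuous (Δ h) := Literature.Analysis.FluidPDE.continuous_laplacian hh2
  have hΔχc : Continuous (Δ χ) := Literature.Analysis.FluidPDE.continuous_laplacian hχ
  have hDh : Continuous (fderiv ℝ h) := hh1.continuous_fderiv one_ne_zero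
  have hDχ : Continuous (fderiv ℝ χ) := hχ1.continuous_fderiv one_ne_zero
  have hΔχcs : HasCompactSupport (Δ χ) := hasCompactSupport_laplacian hχc
  -- the identity for `φ = hχ`
  have hid := energy_identity_bern hflow hφ2 hφc c
  -- Leibniz and the product rule
  have hΔ : ∀ x, (Δ fun y => h y * χ y) x =
      h x * (Δ χ) x + χ x * (Δ h) x + 2 * ∑ i, fderiv ℝ h x (b i) * fderiv ℝ χ x (b i) :=
    fun x => laplacian_mul_eq b hh2 hχ x
  have hD : ∀ x, fderiv ℝ (fun y => h y * χ y) x (v x) = h x * fderiv ℝ χ x (v x) + χ x * fderiv ℝ h x (v x) := by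
    intro x
    rw [fderiv_fun_mul ((hh1.differentiable one_ne_zero) x) ((hχ1.differentiable one_ne_zero) x)]
    rfl
  -- integrability of the pieces (continuous, compactly supported)
  set S₁ : E3 → ℝ := fun x => (h x * (Δ χ) x + 2 * ∑ i, fderiv ℝ h x (b i) * fderiv ℝ χ x (b i)) * ‖v x‖ ^ 2
    with hS₁
  set S₂ : E3 → ℝ := fun x => χ x * (Δ h) x * ‖v x‖ ^ 2 with hS₂
  have hsum_c : Continuous fun x => ∑ i, fderiv ℝ h x (b i) * fderiv ℝ χ x (b i) :=
    continuous_finsetSum _ fun i _ => (hDh.clm_apply continuous_const).mul (hDχ.clm_apply continuous_const)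
  have hsum_cs : HasCompactSupport fun x => ∑ i, fderiv ℝ h x (b i) * fderiv ℝ χ x (b i) := by
    refine HasCompactSupport.of_support_subset_isCompact (hχc.fderiv (𝕜 := ℝ)).isCompact fun x hx => ?_
    contrapose! hx
    have h0 : fderiv ℝ χ x = 0 := by simpa using image_eq_zero_of_notMem_tsupport hx
    simp [h0]
  have iS₁ : Integrable S₁ := by
    refine (((hhc.mul hΔχc).add (continuous_const.mul hsum_c)).mul (hvc.norm.pow 2)).integrable_of_hasCompactSupport ?_
    exact ((hΔχcs.mul_left (f := h)).add (hsum_cs.mul_left)).mul_right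
  have iS₂ : Integrable S₂ :=
    (((hχcn.mul hΔhc)).mul (hvc.norm.pow 2)).integrable_of_hasCompactSupport (hχc.mul_right.mul_right)
  have iT₁ : Integrable fun x => bern v q x * (h x * fderiv ℝ χ x (v x)) :=
    (hbc.mul (hhc.mul (hDχ.clm_apply hvc))).integrable_of_hasCompactSupport
      ((hχc.fderiv (𝕜 := ℝ)).mono fun x hx h0 => hx
        (show bern v q x * (h x * fderiv ℝ χ x (v x)) = 0 by rw [h0]; simp))
  have iT₂ : Integrable fun x => bern v q x * (χ x * fderiv ℝ h x (v x)) :=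
    (hbc.mul (hχcn.mul (hDh.clm_apply hvc))).integrable_of_hasCompactSupport (hχc.mul_right.mul_left)
  -- the signed term
  have hneg : ν / 2 * ∫ x, S₂ x ≤ 0 := by
    have : ∫ x, S₂ x ≤ 0 := integral_nonpos fun x => by
      have h1 := hχ0 x
      have h2 := laplacian_radialProfile_nonpos hR hε x
      have h3 : 0 ≤ ‖v x‖ ^ 2 := by positivity
      rw [hS₂]; exact mul_nonpos_of_nonpos_of_nonneg (mul_nonpos_of_nonneg_of_nonpos h1 h2) h3
    exact mul_nonpos_of_nonneg_of_nonpos (by positivity) this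
  -- rewrite the identity
  have hΔint : ∫ x, (Δ fun y => h y * χ y) x * ‖v x‖ ^ 2 = (∫ x, S₁ x) + ∫ x, S₂ x := by
    rw [← integral_add iS₁ iS₂]
    refine integral_congr_ae (Eventually.of_forall fun x => ?_)
    show (Δ fun y => h y * χ y) x * ‖v x‖ ^ 2 = S₁ x + S₂ x
    rw [hΔ x, hS₁, hS₂]; ring
  have hDint : ∫ x, bern v q x * fderiv ℝ (fun y => h y * χ y) x (v x) =
      (∫ x, bern v q x * (h x * fderiv ℝ χ x (v x))) + ∫ x, bern v q x * (χ x * fderiv ℝ h x (v x)) := by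
    rw [← integral_add iT₁ iT₂]
    refine integral_congr_ae (Eventually.of_forall fun x => ?_)
    show bern v q x * fderiv ℝ (fun y => h y * χ y) x (v x) = _
    rw [hD x]; ring
  have hRHS : ∫ x, testedRHS ν v q h χ x =
      ν / 2 * (∫ x, S₁ x) + ((∫ x, bern v q x * (h x * fderiv ℝ χ x (v x))) +
        ∫ x, bern v q x * (χ x * fderiv ℝ h x (v x))) := by
    have iT : Integrable fun a => bern v q a * (h a * fderiv ℝ χ a (v a)) +
        bern v q a * (χ a * fderiv ℝ h a (v a)) := iT₁.add iT₂
    rw [← integral_add iT₁ iT₂, ← integral_const_mul, ← integral_add (iS₁.const_mul _) iT]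
    refine integral_congr_ae (Eventually.of_forall fun x => ?_)
    show testedRHS ν v q h χ x = ν / 2 * S₁ x + _
    simp only [testedRHS, hS₁]
    ring
  rw [hid, hΔint, hDint, hRHS, mul_add]
  linarith

end Summit.NavierStokesRegularity.NavierStokesRegularity.Theorems.Wu2026Salvage

end

-- WHAT THIS IS NOT: not a claim about NS regularity or blow-up; not a claim about any author beyond the typed locator.
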